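import Literature.NumberTheory.GaloisRepresentations.ContinuousShapiroOpenCoinducedUntwist
import Literature.NumberTheory.GaloisRepresentations.ContinuousShapiroOpenCoinducedDescent
import HarnessLib

/-!
# `#Hⁿ(G, A ⊗ M′)` as a number of twisted fixed vectors in `𝓗ⁿ(A)^d` (Milne ADT I 5.4 + descent)

Topic `NumberTheory/GaloisRepresentations` (continuous cochain cohomology); namespace
`Literature.NumberTheory.GaloisRepresentations` (dot notation under `ContinuousRep`).  Theorems only;
no definition, no named fact, no `sorry`, no instance, no notation.

Let `G` be a compact group, `W ⊴ G` an open normal subgroup of finite index prime to `p`,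
`Δ = G ⧸ W`, `ρ` a continuous representation of `G` on a discrete `A` with `pA = 0`, and
`a, b : Δ → Matrix (Fin d) (Fin d) ℤ` a matrix representation of `Δ` on `A`-valued vectors with a
two-sided inverse (`ContinuousShapiroOpenCoinducedUntwist`: `ha1`, `hamul`, `hab`, `hba`), `M := ρ.piTwist W hW a …`
the twisted module `(Fin d → A)`, `(g x) i = Σ_j a(ḡ) i j • ρ g (x j)` ("`A ⊗ M′`" in coordinates).
Write `𝓗ⁿ := Hⁿ(G, Maps(Δ, A))` (`ρ.coindOpen W hW`, `≅ Hⁿ(W, A)` by Shapiro) with its right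
`Δ`-action `R_c = ρ.coindOpenHRep W hW n c`.  Then (**`natCard_continuousCohomology_piTwist_eq`**)

  `#Hⁿ(G, M) = #{h : Fin d → 𝓗ⁿ | ∀ c, (Σ_j a(c) i j • R_c (h j))ᵢ = h}`,

the number of `Δ`-fixed vectors of `𝓗ⁿ ⊗ M′` in coordinates: prime-to-`p` descent
`Hⁿ(G, M) ≃+ Hⁿ(G, Maps(Δ, M))^Δ` (`descentEquiv`, `ContinuousShapiroOpenCoinducedDescent`) followed by
the untwisting `Hⁿ(G, Maps(Δ, M)) ≃+ (Fin d → 𝓗ⁿ)` carrying `R_c` to `(a(c) i j • R_c)ᵢⱼ`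
(`nonempty_untwist_cohomology_addEquiv`).  Also the `ℤ`-scalar form `(p : ℤ) • x = 0` on `Hⁿ` of a
module killed by `p` (`zsmul_natCast_eq_zero_of_forall`), the hypothesis shape of the finite-group
lemmas it feeds (`RepresentationTheory/FiniteGroups/TensorCoordinatesModP`).

Lane «TATE-EPC-TC» (cell `bsd-eis`, stmt-BirchSwinnertonDyer-19032), brick B8-alg (E1).  HONEST
FRAMING: module bookkeeping for the cyclic prime-to-`p` base case of Tate's global Euler
characteristic formula; no arithmetic statement and no case of BSD is proved here.

## References
* J. S. Milne, *Arithmetic Duality Theorems*, 2nd ed. (2006), I Lemma 5.4, proof of Thm. 5.1. [MilneADT2006]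
* J. Neukirch, A. Schmidt, K. Wingberg, *Cohomology of Number Fields*, 2nd ed. (2008), (1.6.4), (1.5.7). [NeukirchSchmidtWingberg2008]
-/

noncomputable section

open CategoryTheory Function
open scoped Topology

universe u

namespace Literature.NumberTheory.GaloisRepresentations

open _root_.TopRep _root_.ContRepresentation _root_.ContinuousCohomology

namespace ContinuousRep

section

variable {G : Type u} [Group G] [TopologicalSpace G] [IsTopologicalGroup G] [CompactSpace G]
variable {A : Type u} [AddCommGroup A] [TopologicalSpace A] [DiscreteTopology A]
variable (ρ : ContinuousRep G ℤ A) (W : Subgroup G) [W.Normal] (hW : IsOpen (W : Set G)) {d : ℕ} {p : ℕ}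
  (a b : G ⧸ W → Matrix (Fin d) (Fin d) ℤ)
  (ha1 : ∀ x : Fin d → A, matAct (a 1) x = x)
  (hamul : ∀ (c c' : G ⧸ W) (x : Fin d → A), matAct (a (c * c')) x = matAct (a c) (matAct (a c') x))
  (hab : ∀ (c : G ⧸ W) (x : Fin d → A), matAct (a c) (matAct (b c) x) = x)
  (hba : ∀ (c : G ⧸ W) (x : Fin d → A), matAct (b c) (matAct (a c) x) = x)

omit [CompactSpace G] in
/-- `ℤ`-scalar form of "`Hⁿ(G, A)` is killed by `p` when `A` is": `(p : ℤ) • x = 0` (the `•` is the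
`AddCommGroup` one, `SubNegMonoid.zsmul`, on the cohomology carrier).
[cite: NeukirchSchmidtWingberg2008, (1.6.4)] -/
theorem zsmul_natCast_eq_zero_of_forall (p : ℕ) (hp : ∀ v : A, (p : ℤ) • v = 0) (n : ℕ)
    (x : continuousCohomology n ρ.toTopRep) : (p : ℤ) • x = 0 := by
  rw [natCast_zsmul]
  exact ρ.nsmul_eq_zero_of_forall p hp n x

omit [TopologicalSpace G] [IsTopologicalGroup G] [CompactSpace G] [TopologicalSpace A]
  [DiscreteTopology A] [W.Normal] in
/-- `p` kills `A`-valued vectors when it kills `A`. [cite: MilneADT2006, I Lemma 5.4] -/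
theorem zsmul_pi_eq_zero_of_forall (hp : ∀ v : A, (p : ℤ) • v = 0) (x : Fin d → A) :
    (p : ℤ) • x = 0 :=
  funext fun i => by rw [Pi.smul_apply, hp, Pi.zero_apply]

include hab hba in
/-- **`#Hⁿ(G, A ⊗ M′) = #{h : Fin d → 𝓗ⁿ | ∀ c, (Σ_j a(c) i j • R_c (h j))ᵢ = h}`** for `pA = 0`,
`p ∤ [G : W]`: prime-to-`p` descent (`descentEquiv`) followed by the untwisting of
`Hⁿ(G, Maps(Δ, A ⊗ M′))` (`nonempty_untwist_cohomology_addEquiv`).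
[cite: MilneADT2006, I Lemma 5.4, proof of Thm. 5.1] [cite: NeukirchSchmidtWingberg2008, (1.6.4)] -/
theorem natCard_continuousCohomology_piTwist_eq [Fintype (G ⧸ W)] (hp : p.Prime)
    (hpA : ∀ v : A, (p : ℤ) • v = 0) (hcop : ¬ p ∣ Fintype.card (G ⧸ W)) (n : ℕ) :
    Nat.card (continuousCohomology n (ρ.piTwist W hW a ha1 hamul).toTopRep) =
      Nat.card {h : Fin d → continuousCohomology n (ρ.coindOpen W hW).toTopRep //
        ∀ c : G ⧸ W, (fun i => ∑ j, a c i j • ρ.coindOpenHRep W hW n c (h j)) = h} := by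
  rw [(ρ.piTwist W hW a ha1 hamul).natCard_continuousCohomology_eq_natCard_invariants W hW hp
    (fun x => zsmul_pi_eq_zero_of_forall hpA x) hcop n]
  obtain ⟨e, he⟩ := ρ.nonempty_untwist_cohomology_addEquiv W hW a b ha1 hamul hab hba n
  refine Nat.card_congr (e.toEquiv.subtypeEquiv fun x => ?_)
  rw [Representation.mem_invariants]
  refine forall_congr' fun c => ?_
  have hfun : (fun i => ∑ j, a c i j • ρ.coindOpenHRep W hW n c (e x j)) =
      e ((ρ.piTwist W hW a ha1 hamul).coindOpenHRep W hW n c x) :=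
    funext fun i => (he c x i).symm
  change _ ↔ (fun i => ∑ j, a c i j • ρ.coindOpenHRep W hW n c (e x j)) = e x
  rw [hfun, e.apply_eq_iff_eq]

include hab hba in
/-- Product form over degrees `0, 1, 2` (the shape of an Euler-characteristic computation):
`#H⁰(G, A ⊗ M′) · #H²(G, A ⊗ M′) · X = #H¹(G, A ⊗ M′)` iff the same holds for the fixed-vector counts.
[cite: MilneADT2006, I proof of Thm. 5.1] -/
theorem euler_piTwist_iff [Fintype (G ⧸ W)] (hp : p.Prime)
    (hpA : ∀ v : A, (p : ℤ) • v = 0) (hcop : ¬ p ∣ Fintype.card (G ⧸ W)) (X : ℕ) :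
    Nat.card (continuousCohomology 0 (ρ.piTwist W hW a ha1 hamul).toTopRep) *
        Nat.card (continuousCohomology 2 (ρ.piTwist W hW a ha1 hamul).toTopRep) * X =
      Nat.card (continuousCohomology 1 (ρ.piTwist W hW a ha1 hamul).toTopRep) ↔
    Nat.card {h : Fin d → continuousCohomology 0 (ρ.coindOpen W hW).toTopRep //
        ∀ c : G ⧸ W, (fun i => ∑ j, a c i j • ρ.coindOpenHRep W hW 0 c (h j)) = h} *
      Nat.card {h : Fin d → continuousCohomology 2 (ρ.coindOpen W hW).toTopRep //
        ∀ c : G ⧸ W, (fun i => ∑ j, a c i j • ρ.coindOpenHRep W hW 2 c (h j)) = h} * X =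
      Nat.card {h : Fin d → continuousCohomology 1 (ρ.coindOpen W hW).toTopRep //
        ∀ c : G ⧸ W, (fun i => ∑ j, a c i j • ρ.coindOpenHRep W hW 1 c (h j)) = h} := by
  rw [ρ.natCard_continuousCohomology_piTwist_eq W hW a b ha1 hamul hab hba hp hpA hcop 0,
    ρ.natCard_continuousCohomology_piTwist_eq W hW a b ha1 hamul hab hba hp hpA hcop 1,
    ρ.natCard_continuousCohomology_piTwist_eq W hW a b ha1 hamul hab hba hp hpA hcop 2]

end

end ContinuousRep

end Literature.NumberTheory.GaloisRepresentations

end
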